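import Literature.NumberTheory.Automorphic.Liu2021.AppendixC.OmegaHomIsotypicComponent
import HarnessLib

/-!
# [Liu 2021, p. 133 (D.3) / Prop. D.4 (1)] multiplicity one ⇒ the isotypic component of `[·]_K⁻¹ f′(ω^K)` is `[·]_K⁻¹ f′(ω^K)` itself
# (the «multiplicity-free» datum of the ω-block, from the Hecke half of `hIsoSpan`)

Topic `NumberTheory/Automorphic/Liu2021/AppendixC`; namespace `Literature.NumberTheory.Automorphic.Liu2021.AppendixC.Sec42Data.HeckeTranslates`.
THEOREMS ONLY (no definition, no named fact, no instance, no `sorry`).  Sequel to ★ `OmegaHomIsotypicComponent`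
(`map_isotypicComponent_le_span_blockValues`: the isotypic component of `N₀ = [·]_K⁻¹ f′(ω^K)` is carried by `[·]_K ⊗ 1` into the span of the
block values `{f w : f ∈ X.omegaHom ι ρW}`).  Print: [Liu2021] p. 133 (D.3) decomposes `H¹(A_K)` into the `(π^∞)^K`-isotypic parts, and Prop. D.4 (1)
(p. 130) / the proof of Thm. D.6 (l. 5626) use that the relevant `π^∞` occurs with MULTIPLICITY ONE, so that the isotypic part is a single copy of
`(π^∞)^K`.  Here: if the Hom-space `X.omegaHom ι ρW` is spanned by the one element `f′` («multiplicity ≤ 1», the cell՚s S1 input), then the isotypic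
component of `N₀` inside `ℚ̄_ℓ ⊗ H¹_ét(A_K)` IS `N₀` — i.e. the `N₀`-isotypic component is SIMPLE whenever `N₀` is (the `hmf` datum of
★ `MultiplicityFreeImage` for the ω-block).

* `ker_eq_bot_of_mem_omegaHom` — a non-zero element of the Hom-space out of an IRREDUCIBLE `ω` is injective;
* `mem_map_fixedPoints_of_mem_range` — `f′(W) ∩ range([·]_K ⊗ 1) ⊆ f′(ω^K)` (a `K`-fixed value of the injective intertwiner `f′` comes from `ω^K`);
* **`isotypicComponent_eq_of_forall_eq_smul`** — under `∀ f ∈ X.omegaHom ι ρW, ∃ c, f = c • f′`: `isotypicComponent 𝒜 M S = N₀` for every `𝒜`-module `S ≃ N₀`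
  (with `𝒜`, `N₀`, `σ`, `hN₀` exactly as in ★ `OmegaHomIsotypicComponent`).

Count-neutral (`--supports` stmt-HodgeConjecture-24832); HC_CM is proved only modulo the 7 printed citations until rung 0 closes.

## References
* [Liu2021] Y. Liu, *Fourier–Jacobi cycles and arithmetic relative trace formula*, Camb. J. Math. 9 (2021), p. 133 (D.3), Prop. D.4 (1) (p. 130),
  p. 140 (FJcycle.tex l. 5626), §4.2 (l. 2158–2166).
* [Bump1997] D. Bump, *Automorphic Forms and Representations* (1997), Prop. 4.2.3 (p. 427).
-/

set_option autoImplicit false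

noncomputable section

open CategoryTheory NumberField Function MulAction
open scoped TensorProduct

namespace Literature.NumberTheory.Automorphic.Liu2021.AppendixC

open Literature.AlgebraicGeometry.Motives (AbelianVariety)
open Literature.AlgebraicGeometry.Motives.AbelianVariety (rationalTateModuleMap endAlgebra rationalTateAction)

variable {F E : Type} [Field F] [NumberField F] [IsTotallyReal F] [Field E] [NumberField E] [Algebra F E]
  [IsTotallyComplex E] [Algebra.IsQuadraticExtension F E]
variable {P5 : PropC5Data F E} {isotropicAt : ℕ → Prop}

namespace Sec42Data.HeckeTranslates

variable {C : Sec42Data P5 isotropicAt} (T : C.HeckeTranslates) {ℓ : ℕ} [Fact ℓ.Prime]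
variable (K : C5.SmallLevel C.S.K₀)
  (hI : ∀ ⦃K K' : C5.SmallLevel C.S.K₀⦄ (f : K' ⟶ K), Function.Injective (rationalTateModuleMap ℓ (C.Atr f)).dualMap)
  (X : C.EtaleHeckeDatum ℓ) (hX : X.rhoEt = T.etHeckeRep ℓ) (ι : ℂ ≃+* AlgebraicClosure ℚ_[ℓ])
  {W : Type} [AddCommGroup W] [Module ℂ W] (ρW : Representation ℂ C.G W)
  {f : W →ₛₗ[(ι : ℂ →+* AlgebraicClosure ℚ_[ℓ])] AlgebraicClosure ℚ_[ℓ] ⊗[ℚ_[ℓ]] C.etaleH1Tower ℓ} (hf : f ∈ X.omegaHom ι ρW)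
  (σ : Representation (AlgebraicClosure ℚ_[ℓ]) C.G (AlgebraicClosure ℚ_[ℓ] ⊗[ℚ_[ℓ]] C.etaleH1Tower ℓ))
  (hσ : ∀ g : C.G, σ g = (X.rhoEt g).baseChange (AlgebraicClosure ℚ_[ℓ]))

include hf in
/-- **A non-zero element of the Hom-space out of an irreducible `ω` is injective**: its kernel is an `ω`-stable subspace (the Hom-space intertwines
`ρW` with `1 ⊗ rhoEt`), hence `⊥` or `⊤`. [cite: Bump1997, Prop. 4.2.3] [cite: Liu2021, §4.2 (FJcycle.tex l. 2162–2165)] -/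
theorem ker_eq_bot_of_mem_omegaHom [ρW.IsIrreducible] (hf0 : ∃ w : W, f w ≠ 0) : LinearMap.ker f = ⊥ := by
  obtain ⟨U, hU⟩ : ∃ U : Subrepresentation ρW, U.toSubmodule = LinearMap.ker f := by
    refine ⟨⟨LinearMap.ker f, fun g w hw => ?_⟩, rfl⟩
    rw [LinearMap.mem_ker] at hw ⊢
    rw [(Sec42Data.EtaleHeckeDatum.mem_omegaHom_iff X ι ρW f).1 hf g w, hw, map_zero]
  rcases IsSimpleOrder.eq_bot_or_eq_top U with h | h
  · rw [← hU, h]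
    rfl
  · exfalso
    obtain ⟨w, hw⟩ := hf0
    apply hw
    have : w ∈ U.toSubmodule := by rw [h]; trivial
    rw [hU, LinearMap.mem_ker] at this
    exact this

include hf in
/-- **`f′(W) ∩ (ℚ̄_ℓ ⊗ H¹_ét(A_∞))^K = f′(ω^K)`** for an injective element `f′` of the Hom-space: a `K`-fixed value `f′ w` has `w ∈ ω^K` (`f′` intertwines `ρW(k)`
with `rhoEt(k) ⊗ 1`). [cite: Bump1997, Prop. 4.2.3] [cite: Liu2021, §4.2 (FJcycle.tex l. 2160–2166)] -/
theorem mem_map_fixedPoints_of_mem_range (hker : LinearMap.ker f = ⊥) {y : AlgebraicClosure ℚ_[ℓ] ⊗[ℚ_[ℓ]] C.etaleH1Tower ℓ}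
    (hy : y ∈ LinearMap.range f) (hyK : ∀ k ∈ (K.1.1 : Subgroup C.G), (X.rhoEt k).baseChange (AlgebraicClosure ℚ_[ℓ]) y = y) :
    y ∈ (ρW.fixedPoints (K.1.1 : Subgroup C.G)).map f := by
  obtain ⟨w, rfl⟩ := hy
  refine ⟨w, ?_, rfl⟩
  rw [SetLike.mem_coe, Representation.mem_fixedPoints]
  intro k hk
  have h1 : f (ρW k w) = f w := by
    rw [(Sec42Data.EtaleHeckeDatum.mem_omegaHom_iff X ι ρW f).1 hf k w]
    exact hyK k hk
  have h2 : ρW k w - w ∈ LinearMap.ker f := by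
    rw [LinearMap.mem_ker, map_sub, h1, sub_self]
  rw [hker, Submodule.mem_bot, sub_eq_zero] at h2
  exact h2

include hI hX hf hσ in
/-- **MULTIPLICITY ONE ⇒ THE ISOTYPIC COMPONENT OF `N₀ = [·]_K⁻¹ f′(ω^K)` IS `N₀`** ([Liu2021] (D.3) with Prop. D.4 (1): the `(π^∞)^K`-isotypic part of
`H¹(A_K)` is one copy of `(π^∞)^K`).  With `𝒜`, `N₀`, `hN₀`, `σ` as in ★ `OmegaHomIsotypicComponent`: if every element of `X.omegaHom ι ρW` is a multiple of
`f′` and `f′ ≠ 0` on `ω^K`, then for every `𝒜`-module `S ≃ N₀`, `isotypicComponent 𝒜 (ℚ̄_ℓ ⊗ H¹_ét(A_K)) S = N₀`.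
[cite: Liu2021, p. 133 (D.3) and Prop. D.4 (1) (p. 130)] [cite: Bump1997, Prop. 4.2.3] -/
theorem isotypicComponent_eq_of_forall_eq_smul (hD : T.IsogenyDescent) [ρW.IsIrreducible] [σ.IsSemisimpleRepresentation]
    (𝒜 : Subalgebra (AlgebraicClosure ℚ_[ℓ]) (Module.End (AlgebraicClosure ℚ_[ℓ]) (AlgebraicClosure ℚ_[ℓ] ⊗[ℚ_[ℓ]] C.etaleH1 ℓ K)))
    (h𝒜 : ∀ g : C.G, ((rationalTateAction (C.A K) ℓ (T.heckeEnd hD K g)).dualMap).baseChange (AlgebraicClosure ℚ_[ℓ]) ∈ 𝒜)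
    (N₀ : Submodule ↥𝒜 (AlgebraicClosure ℚ_[ℓ] ⊗[ℚ_[ℓ]] C.etaleH1 ℓ K))
    (hN₀ : N₀.restrictScalars (AlgebraicClosure ℚ_[ℓ]) =
      ((ρW.fixedPoints (K.1.1 : Subgroup C.G)).map f).comap ((C.toTower ℓ K).baseChange (AlgebraicClosure ℚ_[ℓ])))
    (hf0 : ∃ w ∈ ρW.fixedPoints (K.1.1 : Subgroup C.G), f w ≠ 0)
    (hm1 : ∀ f₁ ∈ X.omegaHom ι ρW, ∃ c : AlgebraicClosure ℚ_[ℓ], f₁ = c • f)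
    (S : Type*) [AddCommGroup S] [Module ↥𝒜 S] (eS : S ≃ₗ[↥𝒜] ↥N₀) :
    isotypicComponent ↥𝒜 (AlgebraicClosure ℚ_[ℓ] ⊗[ℚ_[ℓ]] C.etaleH1 ℓ K) S = N₀ := by
  have hσ' : ∀ g : C.G, σ g = (T.etHeckeRep ℓ g).baseChange (AlgebraicClosure ℚ_[ℓ]) := fun g => by rw [hσ, hX]
  have hjK : LinearMap.range ((C.toTower ℓ K).baseChange (AlgebraicClosure ℚ_[ℓ])) = σ.fixedPoints (K.1.1 : Subgroup C.G) :=
    T.range_toTower_baseChange_eq_fixedPoints ℓ K hI σ hσ' hD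
  have hker : LinearMap.ker f = ⊥ := by
    obtain ⟨w, -, hw⟩ := hf0
    exact ker_eq_bot_of_mem_omegaHom X ι ρW hf ⟨w, hw⟩
  refine le_antisymm ?_ ?_
  · -- `≤`: block values are multiples of values of `f′`; `K`-fixed values of `f′` come from `ω^K`
    intro y hy
    have hspan : Submodule.span (AlgebraicClosure ℚ_[ℓ]) {y | ∃ f₁ ∈ X.omegaHom ι ρW, ∃ w : W, f₁ w = y} ≤ LinearMap.range f := by
      refine Submodule.span_le.2 ?_
      rintro _ ⟨f₁, hf₁, w, rfl⟩
      obtain ⟨c, rfl⟩ := hm1 f₁ hf₁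
      refine ⟨ι.symm c • w, ?_⟩
      rw [LinearMap.map_smulₛₗ, LinearMap.smul_apply]
      congr 1
      exact ι.apply_symm_apply c
    have hjy := T.map_isotypicComponent_le_span_blockValues K hI X hX ι ρW hf σ hσ hD 𝒜 h𝒜 N₀ hN₀ S eS
      ⟨y, hy, rfl⟩
    have hrange : (C.toTower ℓ K).baseChange (AlgebraicClosure ℚ_[ℓ]) y ∈ LinearMap.range f := hspan hjy
    have hfix : ∀ k ∈ (K.1.1 : Subgroup C.G),
        (X.rhoEt k).baseChange (AlgebraicClosure ℚ_[ℓ]) ((C.toTower ℓ K).baseChange (AlgebraicClosure ℚ_[ℓ]) y) =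
          (C.toTower ℓ K).baseChange (AlgebraicClosure ℚ_[ℓ]) y := by
      intro k hk
      have : (C.toTower ℓ K).baseChange (AlgebraicClosure ℚ_[ℓ]) y ∈ σ.fixedPoints (K.1.1 : Subgroup C.G) := by
        rw [← hjK]
        exact ⟨y, rfl⟩
      rw [Representation.mem_fixedPoints] at this
      rw [← hσ]
      exact this k hk
    have hmem := mem_map_fixedPoints_of_mem_range K X ι ρW hf hker hrange hfix
    have : y ∈ N₀.restrictScalars (AlgebraicClosure ℚ_[ℓ]) := by
      rw [hN₀, Submodule.mem_comap]
      exact hmem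
    exact this
  · -- `≥`: `N₀ ≃ S` is one of the submodules in the supremum
    exact le_sSup ⟨eS.symm⟩

end Sec42Data.HeckeTranslates

end Literature.NumberTheory.Automorphic.Liu2021.AppendixC
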